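import Summits.AtomisticToContinuum.Crystallization.Theorems.FrustratedLawDichotomyMotifDoorE

/-!
# FrustratedLawDichotomy · the Schur-cut residual of record at RANGE 9/2 through the motif doors (instantiation of record)

Critic row 505 (A) (2026-08-31T16:12Z) moved the ENERGETIC RESIDUAL OF RECORD of column 27623 (`AperiodicFrustratedLawGap`) from range `5`
to range `9/2`: `T′♭₄₅ = SchurTopologicalPricing (1/20) (1/8) w₄₅ ω₄ (3/400) (−0.7175) (1/100) C_T` over the closed-form Schur floor
`SF₄₅ = SchurFloor w₄₅ ω₄ (3/400)` (lens-5 g34 §3bis, certified exactly like `SF₅`; census TAG 181-S(i) amendment A, TAG 181-S(ii) at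
range 9/2: strained population 250/250 PASS, margin `+2.36·10⁻³`).  Everything landed at range 5 stays valid (audited twin `T′♭₅`).

This file is the Lean delta the ruling asks for: hand-2 g12's GENERIC doors `aperiodicFrustratedLawGap_of_schurMotif`
(`…PairPotentialDoor`, one motif-certified rule beneath `T′♭`, `E′♭` kept as a hypothesis), its mixed form (E′ infinite-range), and
`aperiodicFrustratedLawGap_of_schurMotifs` (`…MotifDoorE`, TWO motif-certified rules beneath `T′♭` and `E′♭`) INSTANTIATED at
`(w, ω, A, R) = (w₄₅, ω₄, 3/400, 9/2)` via `effPot_fourHalf_eq_zero` (`…SchurCutB`: `W₄₅ = effPot w₄₅ ω₄ A` vanishes from `9/2` on).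
Why the flip is worth it (critic): the motif radius `ϱ ≥ 9/2` cuts the motif atom budget `(20ϱ/7 + 1)³` by ≈ 26 % against `ϱ ≥ 5`.

Also recorded: the residual-class statements at range 9/2 from ONE rule (`schurTopologicalPricing_fourHalf_of_motif`,
`schurRangeGap_fourHalf_of_motif`, `schurElasticPricing_fourHalf_of_motifE`) so that census / lens-5 can cite the 9/2 targets by name.

[folklore] chaining only; 0 sorry.  Prover hand 1, gen 13 (decomp-a2c), `--supports stmt-AtomisticToContinuum-27623`.
-/

noncomputable section

namespace Summit.AtomisticToContinuum.Crystallization.Theorems.FrustratedLawDichotomySchurMotifFourHalf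

open Summit.AtomisticToContinuum.Crystallization.Theorems.FrustratedLawDichotomyRangeCut
open Summit.AtomisticToContinuum.Crystallization.Theorems.FrustratedLawDichotomyLocalDischargingRule
open Summit.AtomisticToContinuum.Crystallization.Theorems.FrustratedLawDichotomySchurCut
open Summit.AtomisticToContinuum.Crystallization.Theorems.FrustratedLawDichotomyPairPotentialDoor
open Summit.AtomisticToContinuum.Crystallization.Theorems.FrustratedLawDichotomyMotifDoorE

/-! ## §1. The three Schur-cut residual classes at range 9/2 from ONE motif-certified rule -/

/-- ★ **`T′♭₄₅(κ_T, C_T) ⟸ motif certificate`** at `(w₄₅, ω₄, 3/400)`: a rule `F` of range `R′`, locality `ρ`, bound `B`, motif radius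
`ϱ ≥ max (9/2, R′ + ρ, ρ, R′, 13/10·D + 1)`, `0 ≤ κ_T, C_T`. [folklore chaining] -/
theorem schurTopologicalPricing_fourHalf_of_motif {η₀ η₁ eUp κT CT D ϱ R' ρ B : ℝ} {F : TransferRule}
    (hF₁ : HasRange R' F) (hF₂ : IsLocal ρ F) (hF₃ : IsBounded B F)
    (hR : 9 / 2 ≤ ϱ) (hRρ : R' + ρ ≤ ϱ) (hρ : ρ ≤ ϱ) (hR' : R' ≤ ϱ) (hD : 13 / 10 * D + 1 ≤ ϱ) (hκ : 0 ≤ κT) (hC : 0 ≤ CT)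
    (h : PairRuleMotifCertificate η₀ η₁ (effPot w₄₅ ω₄ (3 / 400)) (3 / 400) (eUp + κT) (-CT) (-κT) D ϱ F) :
    SchurTopologicalPricing η₀ η₁ w₄₅ ω₄ (3 / 400) eUp κT CT :=
  schurTopologicalPricing_of_motif (fun r hr => effPot_fourHalf_eq_zero _ hr) hF₁ hF₂ hF₃ (by linarith) hR hRρ hρ hR' hD hκ hC h

/-- **`FRG♭₄₅(e₁, C) ⟸ motif certificate`** at `(w₄₅, ω₄, 3/400)` (`0 ≤ C`). [folklore chaining] -/
theorem schurRangeGap_fourHalf_of_motif {η₁ e₁ C D ϱ R' ρ B : ℝ} {F : TransferRule}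
    (hF₁ : HasRange R' F) (hF₂ : IsLocal ρ F) (hF₃ : IsBounded B F)
    (hR : 9 / 2 ≤ ϱ) (hRρ : R' + ρ ≤ ϱ) (hρ : ρ ≤ ϱ) (hR' : R' ≤ ϱ) (hD : 13 / 10 * D + 1 ≤ ϱ) (hC : 0 ≤ C)
    (h : PairRuleMotifCertificate (1 / 20) η₁ (effPot w₄₅ ω₄ (3 / 400)) (3 / 400) e₁ (-C) 0 D ϱ F) :
    SchurRangeGap w₄₅ ω₄ (3 / 400) e₁ C :=
  schurRangeGap_of_motif (fun r hr => effPot_fourHalf_eq_zero _ hr) hF₁ hF₂ hF₃ (by linarith) hR hRρ hρ hR' hD hC h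

/-- **`E′♭₄₅(κ_E, C_E, D_E) ⟸ motif certificate (elastic currency)`** at `(w₄₅, ω₄, 3/400)`: credits of both signs through `…MotifDoorE`
(`0 ≤ κ_E + C_E`, `0 ≤ κ_E + D_E`, `η₁ ≤ 3/10`). [folklore chaining] -/
theorem schurElasticPricing_fourHalf_of_motifE {η₀ η₁ eUp κE CE DE D ϱ R' ρ B : ℝ} {F : TransferRule}
    (hF₁ : HasRange R' F) (hF₂ : IsLocal ρ F) (hF₃ : IsBounded B F)
    (hR : 9 / 2 ≤ ϱ) (hRρ : R' + ρ ≤ ϱ) (hρ : ρ ≤ ϱ) (hR' : R' ≤ ϱ) (hD : 13 / 10 * D + 1 ≤ ϱ)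
    (hneg : 0 ≤ κE + CE) (hpos : 0 ≤ κE + DE) (hη₁ : η₁ ≤ 3 / 10)
    (h : PairRuleMotifCertificateE η₀ η₁ (effPot w₄₅ ω₄ (3 / 400)) (3 / 400) (eUp - DE) (-(κE + CE)) (κE + DE) D ϱ F) :
    SchurElasticPricing η₀ η₁ w₄₅ ω₄ (3 / 400) eUp κE CE DE :=
  schurElasticPricing_of_motifE (fun r hr => effPot_fourHalf_eq_zero _ hr) hF₁ hF₂ hF₃ (by linarith) hR hRρ hρ hR' hD hneg hpos hη₁ h

/-! ## §2. The crux BY NAME at the range-9/2 node -/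

/-- ★★ **The crux at the RANGE-9/2 node from ONE motif-certified rule** (residual of record `T′♭₄₅`, critic row 505 (A)):
`MuEquilibriumDoor ∧ SF₄₅ ∧ UP(−0.7175) ∧ E′♭₄₅(κ_E = 1/1000) ∧ [F : range R′, locality ρ, bound B] ∧ motif certificate
(W₄₅ = effPot w₄₅ ω₄ (3/400), level (−0.7175 + 1/100, −C_T, −1/100), capped scale D, radius ϱ ≥ max (9/2, R′ + ρ, ρ, R′, 13/10·D + 1))
⟹ AperiodicFrustratedLawGap`. [folklore chaining] -/
theorem aperiodicFrustratedLawGap_of_schurMotif_fourHalf {CT CE DE D ϱ R' ρ B : ℝ} {F : TransferRule}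
    (hDoor : Summit.AtomisticToContinuum.Crystallization.Theses.GrainCoreNetworkSplit.MuEquilibriumDoor)
    (hSF : SF₄₅) (hU : PeriodicEnergyCeiling (-(7175 / 10000)))
    (hE : SchurElasticPricing (1 / 20) (1 / 8) w₄₅ ω₄ (3 / 400) (-(7175 / 10000)) (1 / 1000) CE DE)
    (hF₁ : HasRange R' F) (hF₂ : IsLocal ρ F) (hF₃ : IsBounded B F)
    (hR : 9 / 2 ≤ ϱ) (hRρ : R' + ρ ≤ ϱ) (hρ : ρ ≤ ϱ) (hR' : R' ≤ ϱ) (hD : 13 / 10 * D + 1 ≤ ϱ) (hC : 0 ≤ CT)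
    (h : PairRuleMotifCertificate (1 / 20) (1 / 8) (effPot w₄₅ ω₄ (3 / 400)) (3 / 400) (-(7175 / 10000) + 1 / 100) (-CT) (-(1 / 100))
      D ϱ F) :
    Summit.AtomisticToContinuum.Crystallization.Theses.FrustratedLawDichotomy.AperiodicFrustratedLawGap :=
  aperiodicFrustratedLawGap_of_schurMotif (by norm_num) hDoor hSF hU (by norm_num) (by norm_num) hE
    (fun r hr => effPot_fourHalf_eq_zero _ hr) hF₁ hF₂ hF₃ (by linarith) hR hRρ hρ hR' hD hC h

/-- **Mixed form at range 9/2** (E′ kept infinite-range): `MuEquilibriumDoor ∧ E′(1/20, 1/8) ∧ SF₄₅ ∧ UP(−0.7175) ∧ rule ∧ motif certificate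
⟹ AperiodicFrustratedLawGap`. [folklore chaining] -/
theorem aperiodicFrustratedLawGap_of_elastic_of_schurMotif_fourHalf {CT D ϱ R' ρ B : ℝ} {F : TransferRule}
    (hDoor : Summit.AtomisticToContinuum.Crystallization.Theses.GrainCoreNetworkSplit.MuEquilibriumDoor)
    (hE : ElasticPricing (1 / 20) (1 / 8)) (hSF : SF₄₅) (hU : PeriodicEnergyCeiling (-(7175 / 10000)))
    (hF₁ : HasRange R' F) (hF₂ : IsLocal ρ F) (hF₃ : IsBounded B F)
    (hR : 9 / 2 ≤ ϱ) (hRρ : R' + ρ ≤ ϱ) (hρ : ρ ≤ ϱ) (hR' : R' ≤ ϱ) (hD : 13 / 10 * D + 1 ≤ ϱ) (hC : 0 ≤ CT)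
    (h : PairRuleMotifCertificate (1 / 20) (1 / 8) (effPot w₄₅ ω₄ (3 / 400)) (3 / 400) (-(7175 / 10000) + 1 / 100) (-CT) (-(1 / 100))
      D ϱ F) :
    Summit.AtomisticToContinuum.Crystallization.Theses.FrustratedLawDichotomy.AperiodicFrustratedLawGap :=
  aperiodicFrustratedLawGap_of_fdg hDoor
    (fdg_of_elastic_of_schurCut (by norm_num) hE hSF hU (by norm_num)
      (schurTopologicalPricing_fourHalf_of_motif hF₁ hF₂ hF₃ hR hRρ hρ hR' hD (by norm_num) hC h))

/-- ★★ **The crux at the RANGE-9/2 node from TWO motif-certified rules** (`F_T` beneath `T′♭₄₅` with level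
`(−0.7175 + 1/100, −C_T, −1/100)`, `F_E` beneath `E′♭₄₅` with level `(−0.7175 − D_E, −(1/1000 + C_E), 1/1000 + D_E)`; `C_T, C_E, D_E ≥ 0`
free; one motif radius `ϱ ≥ max (9/2, R′ + ρ, ρ, R′, R″ + ρ′, ρ′, R″, 13/10·D + 1)`): after this, every hypothesis of the energetic feed of
column 27623 at the residual of record except the two FINITE motif families is `MuEquilibriumDoor` (proved), `SF₄₅` (KNOWN · CERTIFIED) or
`UP(−0.7175)` (a tree number). [folklore chaining] -/
theorem aperiodicFrustratedLawGap_of_schurMotifs_fourHalf {CT CE DE D ϱ R' ρ B R'' ρ' B' : ℝ} {FT FE : TransferRule}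
    (hDoor : Summit.AtomisticToContinuum.Crystallization.Theses.GrainCoreNetworkSplit.MuEquilibriumDoor)
    (hSF : SF₄₅) (hU : PeriodicEnergyCeiling (-(7175 / 10000))) (hCT : 0 ≤ CT) (hCE : 0 ≤ CE) (hDE : 0 ≤ DE)
    (hT₁ : HasRange R' FT) (hT₂ : IsLocal ρ FT) (hT₃ : IsBounded B FT)
    (hE₁ : HasRange R'' FE) (hE₂ : IsLocal ρ' FE) (hE₃ : IsBounded B' FE)
    (hR : 9 / 2 ≤ ϱ) (hRρ : R' + ρ ≤ ϱ) (hρ : ρ ≤ ϱ) (hR' : R' ≤ ϱ) (hRρ' : R'' + ρ' ≤ ϱ) (hρ'' : ρ' ≤ ϱ) (hR''' : R'' ≤ ϱ)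
    (hD : 13 / 10 * D + 1 ≤ ϱ)
    (hT : PairRuleMotifCertificate (1 / 20) (1 / 8) (effPot w₄₅ ω₄ (3 / 400)) (3 / 400) (-(7175 / 10000) + 1 / 100) (-CT) (-(1 / 100))
      D ϱ FT)
    (hE : PairRuleMotifCertificateE (1 / 20) (1 / 8) (effPot w₄₅ ω₄ (3 / 400)) (3 / 400) (-(7175 / 10000) - DE) (-(1 / 1000 + CE))
      (1 / 1000 + DE) D ϱ FE) :
    Summit.AtomisticToContinuum.Crystallization.Theses.FrustratedLawDichotomy.AperiodicFrustratedLawGap :=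
  aperiodicFrustratedLawGap_of_split_schurCut (by norm_num) hDoor hSF hU (by norm_num)
    (schurTopologicalPricing_fourHalf_of_motif hT₁ hT₂ hT₃ hR hRρ hρ hR' hD (by norm_num) hCT hT) (by norm_num)
    (schurElasticPricing_fourHalf_of_motifE hE₁ hE₂ hE₃ hR hRρ' hρ'' hR''' hD (by linarith) (by linarith) (by norm_num) hE)

/-- **The sibling `PeriodicFrustratedLawGap` (item 27624) at the range-9/2 node from ONE motif-certified rule beneath `FRG♭₄₅`**
(`e₁ = −0.7174`, `0 ≤ C`). [folklore chaining] -/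
theorem periodicFrustratedLawGap_of_schurMotif_fourHalf {C D ϱ R' ρ B : ℝ} {F : TransferRule}
    (hDoor : Summit.AtomisticToContinuum.Crystallization.Theses.GrainCoreNetworkSplit.MuEquilibriumDoor)
    (hSF : SF₄₅) (hU : PeriodicEnergyCeiling (-(7175 / 10000)))
    (hF₁ : HasRange R' F) (hF₂ : IsLocal ρ F) (hF₃ : IsBounded B F)
    (hR : 9 / 2 ≤ ϱ) (hRρ : R' + ρ ≤ ϱ) (hρ : ρ ≤ ϱ) (hR' : R' ≤ ϱ) (hD : 13 / 10 * D + 1 ≤ ϱ) (hC : 0 ≤ C)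
    (h : PairRuleMotifCertificate (1 / 20) (1 / 8) (effPot w₄₅ ω₄ (3 / 400)) (3 / 400) (-(7174 / 10000)) (-C) 0 D ϱ F) :
    Summit.AtomisticToContinuum.Crystallization.Theses.FrustratedLawDichotomy.PeriodicFrustratedLawGap :=
  periodicFrustratedLawGap_of_schurCut hDoor hSF hU
    (schurRangeGap_fourHalf_of_motif hF₁ hF₂ hF₃ hR hRρ hρ hR' hD hC h) (by norm_num)

end Summit.AtomisticToContinuum.Crystallization.Theorems.FrustratedLawDichotomySchurMotifFourHalf

end
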